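import Summits.KontsevichZagierPeriods.KontsevichZagierPeriods.Theorems.RealOnePeriodRelations.Negative.Kit
import Literature.NumberTheory.Transcendental.CurvePeriods

/-!
# `RealOnePeriodRelations` (stmt-KontsevichZagierPeriods-10042), line `nash-retraction-thin-strip` —
# stub `stub_normalisation`: reduction to single representations

The normalisation stub `Ψ` of the crux skeleton (`Cruxes/RealOnePeriodRelations/Lines/nash-retraction-thin-strip.lean`,
reshape 2) asks, for every `c ∈ H₁ = closure (range of₁)`, for a finitely supported family of algebraic
coefficients `C` on period symbols of curve type with `ℚ`-semialgebraic paths, and real realisations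
`R s = [∫₀¹ Re(C s · Σᵢ ωᵢ(γ)γᵢ′)]`, with `evalCombination C = eval c` and `c ≡ Σ_s [R s] (mod M₁)`.

This file proves the ADDITIVE BOOKKEEPING half once and for all (`helper_normalisation_r0_1`, a registered
helper anchor of `stub_normalisation`): the normalisation property is stable under `0`, `+`, `−` modulo `M₁`
— given that realisations exist along every semialgebraic symbol path (hypothesis = the registered
`stub_realises`, verbatim), they are additive in the scalar by rule 1b, and a realisation of the scalar `0` is a zero integrand — so by
`AddSubgroup.closure_induction` it suffices to normalise the GENERATORS `[r]`, `r : IntegralRep 1`.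
What remains of `stub_normalisation` after this file is the geometric core for ONE representation
`[∫_σ f]` (cells at the algebraic bad points by 1a, rule-2 compactification/flattening, lift of each real
algebraic arc to a smooth affine model).

References: M. Kontsevich, D. Zagier, *Periods* (2001), §1.2; A. Huber, G. Wüstholz, *Transcendence and
Linear Relations of 1-Periods* (2022), §13.2.1.
-/

noncomputable section

open scoped BigOperators
open Set MeasureTheory
open Literature.NumberTheory.Transcendental Literature.NumberTheory.Transcendental.CurvePeriods
open Literature.ModelTheory.ExponentialFields (IsSemialgebraic)
open Summit.KontsevichZagierPeriods.SymplecticScissors.RealOnePeriodRelationsNegative (M₁ H₁ unitDom constRep₁)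

namespace Summit.KontsevichZagierPeriods.SymplecticScissors.RealOnePeriodRelations

namespace NormalisationReduction

/-- Rule 1b inside `M₁`: if `r`, `r₁`, `r₂` have the same domain and `r = r₁ + r₂` on it, then
`[r] − [r₁] − [r₂] ∈ M₁`. [cite: KontsevichZagier2001, §1.2 rule (1)] -/
theorem sub_sub_mem_M₁ {n : ℕ} (r r₁ r₂ : KZ.IntegralRep n) (h₁ : r₁.domain = r.domain)
    (h₂ : r₂.domain = r.domain) (h : ∀ x ∈ r.domain, r.integrand x = r₁.integrand x + r₂.integrand x) :
    KZ.of r - KZ.of r₁ - KZ.of r₂ ∈ M₁ := by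
  refine AddSubgroup.subset_closure (Or.inl (Or.inl (Or.inr ?_)))
  exact ⟨n, r, r₁, r₂, h₁, h₂, fun x hx => by simpa using h x hx, rfl⟩

/-- A representation whose integrand vanishes on its domain lies in `M₁` (`[r] − [r] − [r]` is a 1b
instance). [cite: KontsevichZagier2001, §1.2 rule (1)] -/
theorem of_mem_M₁_of_integrand_zero {n : ℕ} (r : KZ.IntegralRep n) (h : ∀ x ∈ r.domain, r.integrand x = 0) :
    KZ.of r ∈ M₁ := by
  have h3 : KZ.of r - KZ.of r - KZ.of r ∈ M₁ :=
    sub_sub_mem_M₁ r r r rfl rfl fun x hx => by rw [h x hx, add_zero]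
  have e : KZ.of r = -(KZ.of r - KZ.of r - KZ.of r) := by abel
  rw [e]
  exact M₁.neg_mem h3

/-- If `r₁ + r₂ = 0` on a common domain equal to `unitDom`, then `[r₁] + [r₂] ∈ M₁`. [folklore] -/
theorem add_mem_M₁_of_integrand_add_eq_zero (r₁ r₂ : KZ.IntegralRep 1)
    (h₁ : r₁.domain = {z | z 0 ∈ Set.Ioo (0 : ℝ) 1}) (h₂ : r₂.domain = {z | z 0 ∈ Set.Ioo (0 : ℝ) 1})
    (h : ∀ x ∈ r₁.domain, r₁.integrand x + r₂.integrand x = 0) : KZ.of r₁ + KZ.of r₂ ∈ M₁ := by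
  have hz : KZ.of (constRep₁ 0) ∈ M₁ :=
    of_mem_M₁_of_integrand_zero _ fun x _ => by simp
  have h3 : KZ.of (constRep₁ 0) - KZ.of r₁ - KZ.of r₂ ∈ M₁ := by
    refine sub_sub_mem_M₁ (constRep₁ 0) r₁ r₂ h₁ h₂ fun x hx => ?_
    have hx' : x ∈ r₁.domain := by rw [h₁]; exact hx
    simpa using (h x hx').symm
  have e : KZ.of r₁ + KZ.of r₂ = KZ.of (constRep₁ 0) - (KZ.of (constRep₁ 0) - KZ.of r₁ - KZ.of r₂) := by abel
  rw [e]
  exact M₁.sub_mem hz h3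

/-- If `r = r₁` on a common domain equal to `unitDom`, then `[r] − [r₁] ∈ M₁`. [folklore] -/
theorem sub_mem_M₁_of_integrand_eq (r r₁ : KZ.IntegralRep 1)
    (h₀ : r.domain = {z | z 0 ∈ Set.Ioo (0 : ℝ) 1}) (h₁ : r₁.domain = {z | z 0 ∈ Set.Ioo (0 : ℝ) 1})
    (h : ∀ x ∈ r.domain, r.integrand x = r₁.integrand x) : KZ.of r - KZ.of r₁ ∈ M₁ := by
  have hz : KZ.of (constRep₁ 0) ∈ M₁ :=
    of_mem_M₁_of_integrand_zero _ fun x _ => by simp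
  have h3 : KZ.of r - KZ.of r₁ - KZ.of (constRep₁ 0) ∈ M₁ := by
    refine sub_sub_mem_M₁ r r₁ (constRep₁ 0) (by rw [h₀, h₁]) (by rw [h₀]; rfl) fun x hx => ?_
    simpa using h x hx
  have e : KZ.of r - KZ.of r₁ = (KZ.of r - KZ.of r₁ - KZ.of (constRep₁ 0)) + KZ.of (constRep₁ 0) := by abel
  rw [e]
  exact M₁.add_mem h3 hz

/-- The real part of the realisation integrand is additive in the scalar. [folklore] -/
theorem re_add_mul (a b X : ℂ) : ((a + b) * X).re = (a * X).re + (b * X).re := by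
  rw [add_mul, Complex.add_re]

/-- Evaluation of the negative of a combination of symbols. [folklore] -/
theorem evalCombination_neg (C : PeriodSymbol →₀ ℂ) : evalCombination (-C) = -evalCombination C := by
  rw [← neg_one_smul ℂ C, evalCombination_smul, neg_one_mul]

/-- Evaluation of the zero combination. [folklore] -/
theorem evalCombination_zero : evalCombination (0 : PeriodSymbol →₀ ℂ) = 0 := by
  simp [evalCombination]

end NormalisationReduction

open NormalisationReduction in
/-- **Reduction of the normalisation stub to generators** (registered helper anchor
`helper_normalisation_r0_1` of `stub_normalisation`). The normalisation property of `c` — "there are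
algebraic coefficients `C` on period symbols with `ℚ`-semialgebraic paths and real realisations `R s` of
`C s · (s.ω, s.γ)` on `(0,1)` with `evalCombination C = eval c` and `c − Σ_{s ∈ supp C} [R s] ∈ M₁`" —
holds for every `c ∈ H₁` as soon as it holds for every generator `[r₀]`, `r₀ : IntegralRep 1`: it is
stable under `0`, `+` and `−` (realisations exist along semialgebraic symbol paths by the hypothesis — the
registered `stub_realises`, written out —, are additive in the scalar modulo `M₁` by rule 1b, and realise `0`
by a zero integrand), and `H₁ = closure (range of₁)` (`AddSubgroup.closure_induction`).
[cite: KontsevichZagier2001, §1.2] -/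
theorem helper_normalisation_r0_1 :
    (∀ (Z : CurveData) (γ : CurvePath Z),
      IsSemialgebraicMapOn ℚ {z : Fin 1 → ℝ | z 0 ∈ Set.Icc (0 : ℝ) 1}
        (fun z => Fin.append (fun i => (γ.toFun (z 0) i).re) (fun i => (γ.toFun (z 0) i).im)) →
      ∀ (ω : Fin Z.n → MvPolynomial (Fin Z.n) ℂ), (∀ i, HasAlgCoeffs (ω i)) → ∀ (a : ℂ), IsAlgebraic ℚ a →
      ∃ r : KZ.IntegralRep 1, r.domain = {z | z 0 ∈ Set.Ioo (0 : ℝ) 1} ∧ ∀ z ∈ r.domain, r.integrand z =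
        (a * ∑ i, MvPolynomial.eval (γ.toFun (z 0)) (ω i) * deriv (fun u => γ.toFun u i) (z 0)).re) →
    (∀ r₀ : KZ.IntegralRep 1, ∃ (C : PeriodSymbol →₀ ℂ) (R : PeriodSymbol → KZ.IntegralRep 1),
      (∀ s, IsAlgebraic ℚ (C s)) ∧
      (∀ s ∈ C.support, IsSemialgebraicMapOn ℚ {z : Fin 1 → ℝ | z 0 ∈ Set.Icc (0 : ℝ) 1}
        (fun z => Fin.append (fun i => (s.γ.toFun (z 0) i).re) (fun i => (s.γ.toFun (z 0) i).im))) ∧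
      (∀ s ∈ C.support, (R s).domain = {z | z 0 ∈ Set.Ioo (0 : ℝ) 1} ∧ ∀ z ∈ (R s).domain, (R s).integrand z =
        (C s * ∑ i, MvPolynomial.eval (s.γ.toFun (z 0)) (s.ω i) * deriv (fun u => s.γ.toFun u i) (z 0)).re) ∧
      evalCombination C = ((KZ.eval (KZ.of r₀) : ℝ) : ℂ) ∧ KZ.of r₀ - ∑ s ∈ C.support, KZ.of (R s) ∈ M₁) →
    ∀ c : KZ.FormalRep, c ∈ H₁ → ∃ (C : PeriodSymbol →₀ ℂ) (R : PeriodSymbol → KZ.IntegralRep 1),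
      (∀ s, IsAlgebraic ℚ (C s)) ∧
      (∀ s ∈ C.support, IsSemialgebraicMapOn ℚ {z : Fin 1 → ℝ | z 0 ∈ Set.Icc (0 : ℝ) 1}
        (fun z => Fin.append (fun i => (s.γ.toFun (z 0) i).re) (fun i => (s.γ.toFun (z 0) i).im))) ∧
      (∀ s ∈ C.support, (R s).domain = {z | z 0 ∈ Set.Ioo (0 : ℝ) 1} ∧ ∀ z ∈ (R s).domain, (R s).integrand z =
        (C s * ∑ i, MvPolynomial.eval (s.γ.toFun (z 0)) (s.ω i) * deriv (fun u => s.γ.toFun u i) (z 0)).re) ∧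
      evalCombination C = ((KZ.eval c : ℝ) : ℂ) ∧ c - ∑ s ∈ C.support, KZ.of (R s) ∈ M₁ := by
  intro hreal hgen c hc
  induction hc using AddSubgroup.closure_induction with
  | mem x hx =>
    obtain ⟨r, rfl⟩ := hx
    exact hgen r
  | zero =>
    refine ⟨0, fun _ => constRep₁ 0, fun _ => ?_, fun s hs => ?_, fun s hs => ?_, ?_, ?_⟩
    · simpa using isAlgebraic_zero
    · simp at hs
    · simp at hs
    · rw [evalCombination_zero, map_zero]
      simp
    · simp [M₁.zero_mem]
  | add x y _ _ ihx ihy =>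
    obtain ⟨C₁, R₁, halg₁, hSA₁, hR₁, hev₁, hM₁⟩ := ihx
    obtain ⟨C₂, R₂, halg₂, hSA₂, hR₂, hev₂, hM₂⟩ := ihy
    classical
    -- semialgebraicity of the path of every symbol met
    have hSA : ∀ s, s ∈ C₁.support ∨ s ∈ C₂.support →
        IsSemialgebraicMapOn ℚ {z : Fin 1 → ℝ | z 0 ∈ Set.Icc (0 : ℝ) 1}
          (fun z => Fin.append (fun i => (s.γ.toFun (z 0) i).re) (fun i => (s.γ.toFun (z 0) i).im)) := by
      rintro s (hs | hs)
      · exact hSA₁ s hs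
      · exact hSA₂ s hs
    have halg : ∀ s, IsAlgebraic ℚ (C₁ s + C₂ s) := fun s => (halg₁ s).add (halg₂ s)
    -- the new realisations: along each symbol met, realise the summed scalar
    have hex : ∀ s, s ∈ C₁.support ∨ s ∈ C₂.support → ∃ r : KZ.IntegralRep 1,
        r.domain = {z | z 0 ∈ Set.Ioo (0 : ℝ) 1} ∧ ∀ z ∈ r.domain, r.integrand z =
          ((C₁ s + C₂ s) * ∑ i, MvPolynomial.eval (s.γ.toFun (z 0)) (s.ω i) *
            deriv (fun u => s.γ.toFun u i) (z 0)).re :=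
      fun s hs => hreal s.Z s.γ (hSA s hs) s.ω s.ω_algebraic _ (halg s)
    let R : PeriodSymbol → KZ.IntegralRep 1 := fun s =>
      if hs : s ∈ C₁.support ∨ s ∈ C₂.support then Classical.choose (hex s hs) else constRep₁ 0
    have hRspec : ∀ s (hs : s ∈ C₁.support ∨ s ∈ C₂.support),
        (R s).domain = {z | z 0 ∈ Set.Ioo (0 : ℝ) 1} ∧ ∀ z ∈ (R s).domain, (R s).integrand z =
          ((C₁ s + C₂ s) * ∑ i, MvPolynomial.eval (s.γ.toFun (z 0)) (s.ω i) *
            deriv (fun u => s.γ.toFun u i) (z 0)).re := by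
      intro s hs
      have hR : R s = Classical.choose (hex s hs) := dif_pos hs
      rw [hR]
      exact Classical.choose_spec (hex s hs)
    have hsupp : (C₁ + C₂).support ⊆ C₁.support ∪ C₂.support := Finsupp.support_add
    have hmem_of : ∀ s ∈ (C₁ + C₂).support, s ∈ C₁.support ∨ s ∈ C₂.support := fun s hs => by
      simpa [Finset.mem_union] using hsupp hs
    refine ⟨C₁ + C₂, R, halg, fun s hs => hSA s (hmem_of s hs), fun s hs => ?_, ?_, ?_⟩
    · simpa only [Finsupp.add_apply] using hRspec s (hmem_of s hs)
    · rw [evalCombination_add, hev₁, hev₂, map_add]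
      push_cast
      ring
    · -- the `M₁` bookkeeping
      set T : Finset PeriodSymbol := C₁.support ∪ C₂.support with hT
      -- termwise contributions
      let g₁ : PeriodSymbol → KZ.FormalRep := fun s => if s ∈ C₁.support then KZ.of (R₁ s) else 0
      let g₂ : PeriodSymbol → KZ.FormalRep := fun s => if s ∈ C₂.support then KZ.of (R₂ s) else 0
      let g : PeriodSymbol → KZ.FormalRep := fun s => if s ∈ (C₁ + C₂).support then KZ.of (R s) else 0
      have hg₁ : ∑ s ∈ T, g₁ s = ∑ s ∈ C₁.support, KZ.of (R₁ s) := by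
        rw [← Finset.sum_subset (Finset.subset_union_left (s₂ := C₂.support))
          (fun s _ hs => by simp only [g₁, if_neg hs])]
        exact Finset.sum_congr rfl fun s hs => by simp only [g₁, if_pos hs]
      have hg₂ : ∑ s ∈ T, g₂ s = ∑ s ∈ C₂.support, KZ.of (R₂ s) := by
        rw [← Finset.sum_subset (Finset.subset_union_right (s₁ := C₁.support))
          (fun s _ hs => by simp only [g₂, if_neg hs])]
        exact Finset.sum_congr rfl fun s hs => by simp only [g₂, if_pos hs]
      have hg : ∑ s ∈ T, g s = ∑ s ∈ (C₁ + C₂).support, KZ.of (R s) := by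
        rw [← Finset.sum_subset hsupp (fun s _ hs => by simp only [g, if_neg hs])]
        exact Finset.sum_congr rfl fun s hs => by simp only [g, if_pos hs]
      -- each termwise contribution lies in `M₁`
      have hterm : ∀ s ∈ T, g₁ s + g₂ s - g s ∈ M₁ := by
        intro s hsT
        have hs12 : s ∈ C₁.support ∨ s ∈ C₂.support := by simpa [hT, Finset.mem_union] using hsT
        obtain ⟨hRd, hRi⟩ := hRspec s hs12
        by_cases h1 : s ∈ C₁.support <;> by_cases h2 : s ∈ C₂.support
        · -- both: `R₁ + R₂ ≡ R` (1b), or `R₁ + R₂ ≡ 0` if the scalars cancel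
          obtain ⟨hR₁d, hR₁i⟩ := hR₁ s h1
          obtain ⟨hR₂d, hR₂i⟩ := hR₂ s h2
          by_cases h : s ∈ (C₁ + C₂).support
          · simp only [g₁, g₂, g, if_pos h1, if_pos h2, if_pos h]
            have h3 : KZ.of (R s) - KZ.of (R₁ s) - KZ.of (R₂ s) ∈ M₁ := by
              refine sub_sub_mem_M₁ (R s) (R₁ s) (R₂ s) (by rw [hR₁d, hRd]) (by rw [hR₂d, hRd]) ?_
              intro x hx
              have hx₁ : x ∈ (R₁ s).domain := by rw [hR₁d]; rw [hRd] at hx; exact hx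
              have hx₂ : x ∈ (R₂ s).domain := by rw [hR₂d]; rw [hRd] at hx; exact hx
              rw [hRi x hx, hR₁i x hx₁, hR₂i x hx₂, re_add_mul]
            have e : KZ.of (R₁ s) + KZ.of (R₂ s) - KZ.of (R s) =
                -(KZ.of (R s) - KZ.of (R₁ s) - KZ.of (R₂ s)) := by abel
            rw [e]
            exact M₁.neg_mem h3
          · simp only [g₁, g₂, g, if_pos h1, if_pos h2, if_neg h, sub_zero]
            have h0 : C₁ s + C₂ s = 0 := by
              simpa [Finsupp.mem_support_iff, Finsupp.add_apply] using h
            refine add_mem_M₁_of_integrand_add_eq_zero (R₁ s) (R₂ s) hR₁d hR₂d fun x hx => ?_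
            have hx₂ : x ∈ (R₂ s).domain := by rw [hR₂d]; rw [hR₁d] at hx; exact hx
            rw [hR₁i x hx, hR₂i x hx₂, ← re_add_mul, h0, zero_mul, Complex.zero_re]
        · -- only in `supp C₁`
          obtain ⟨hR₁d, hR₁i⟩ := hR₁ s h1
          have hC₂ : C₂ s = 0 := by simpa [Finsupp.mem_support_iff] using h2
          have h : s ∈ (C₁ + C₂).support := by
            have : C₁ s ≠ 0 := by simpa [Finsupp.mem_support_iff] using h1
            simpa [Finsupp.mem_support_iff, Finsupp.add_apply, hC₂] using this
          simp only [g₁, g₂, g, if_pos h1, if_neg h2, if_pos h, add_zero]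
          refine sub_mem_M₁_of_integrand_eq (R₁ s) (R s) hR₁d hRd fun x hx => ?_
          have hx' : x ∈ (R s).domain := by rw [hRd]; rw [hR₁d] at hx; exact hx
          rw [hR₁i x hx, hRi x hx', hC₂, add_zero]
        · -- only in `supp C₂`
          obtain ⟨hR₂d, hR₂i⟩ := hR₂ s h2
          have hC₁ : C₁ s = 0 := by simpa [Finsupp.mem_support_iff] using h1
          have h : s ∈ (C₁ + C₂).support := by
            have : C₂ s ≠ 0 := by simpa [Finsupp.mem_support_iff] using h2
            simpa [Finsupp.mem_support_iff, Finsupp.add_apply, hC₁] using this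
          simp only [g₁, g₂, g, if_neg h1, if_pos h2, if_pos h, zero_add]
          refine sub_mem_M₁_of_integrand_eq (R₂ s) (R s) hR₂d hRd fun x hx => ?_
          have hx' : x ∈ (R s).domain := by rw [hRd]; rw [hR₂d] at hx; exact hx
          rw [hR₂i x hx, hRi x hx', hC₁, zero_add]
        · exact absurd hs12 (by simp [h1, h2])
      have hsum : ∑ s ∈ T, (g₁ s + g₂ s - g s) ∈ M₁ := sum_mem fun s hs => hterm s hs
      rw [Finset.sum_sub_distrib, Finset.sum_add_distrib, hg₁, hg₂, hg] at hsum
      have e : x + y - ∑ s ∈ (C₁ + C₂).support, KZ.of (R s) =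
          (x - ∑ s ∈ C₁.support, KZ.of (R₁ s)) + (y - ∑ s ∈ C₂.support, KZ.of (R₂ s)) +
            (∑ s ∈ C₁.support, KZ.of (R₁ s) + ∑ s ∈ C₂.support, KZ.of (R₂ s) -
              ∑ s ∈ (C₁ + C₂).support, KZ.of (R s)) := by abel
      rw [e]
      exact M₁.add_mem (M₁.add_mem hM₁ hM₂) hsum
  | neg x _ ih =>
    obtain ⟨C, R, halg, hSA, hR, hev, hM⟩ := ih
    classical
    have hex : ∀ s ∈ C.support, ∃ r : KZ.IntegralRep 1,
        r.domain = {z | z 0 ∈ Set.Ioo (0 : ℝ) 1} ∧ ∀ z ∈ r.domain, r.integrand z =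
          ((-C s) * ∑ i, MvPolynomial.eval (s.γ.toFun (z 0)) (s.ω i) *
            deriv (fun u => s.γ.toFun u i) (z 0)).re :=
      fun s hs => hreal s.Z s.γ (hSA s hs) s.ω s.ω_algebraic _ (halg s).neg
    let R' : PeriodSymbol → KZ.IntegralRep 1 := fun s =>
      if hs : s ∈ C.support then Classical.choose (hex s hs) else constRep₁ 0
    have hRspec : ∀ s (hs : s ∈ C.support),
        (R' s).domain = {z | z 0 ∈ Set.Ioo (0 : ℝ) 1} ∧ ∀ z ∈ (R' s).domain, (R' s).integrand z =
          ((-C s) * ∑ i, MvPolynomial.eval (s.γ.toFun (z 0)) (s.ω i) *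
            deriv (fun u => s.γ.toFun u i) (z 0)).re := by
      intro s hs
      have h : R' s = Classical.choose (hex s hs) := dif_pos hs
      rw [h]
      exact Classical.choose_spec (hex s hs)
    refine ⟨-C, R', fun s => by simpa using (halg s).neg, fun s hs => hSA s (by simpa using hs),
      fun s hs => ?_, ?_, ?_⟩
    · have hs' : s ∈ C.support := by simpa using hs
      simpa only [Finsupp.neg_apply] using hRspec s hs'
    · rw [evalCombination_neg, hev, map_neg]
      push_cast
      ring
    · have hsupp : (-C).support = C.support := Finsupp.support_neg C
      rw [hsupp]
      have hterm : ∀ s ∈ C.support, KZ.of (R s) + KZ.of (R' s) ∈ M₁ := by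
        intro s hs
        obtain ⟨hRd, hRi⟩ := hR s hs
        obtain ⟨hR'd, hR'i⟩ := hRspec s hs
        refine add_mem_M₁_of_integrand_add_eq_zero (R s) (R' s) hRd hR'd fun x hx => ?_
        have hx' : x ∈ (R' s).domain := by rw [hR'd]; rw [hRd] at hx; exact hx
        rw [hRi x hx, hR'i x hx', ← re_add_mul, add_neg_cancel, zero_mul, Complex.zero_re]
      have hsum : ∑ s ∈ C.support, (KZ.of (R s) + KZ.of (R' s)) ∈ M₁ := sum_mem fun s hs => hterm s hs
      rw [Finset.sum_add_distrib] at hsum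
      have e : -x - ∑ s ∈ C.support, KZ.of (R' s) =
          -(x - ∑ s ∈ C.support, KZ.of (R s)) -
            (∑ s ∈ C.support, KZ.of (R s) + ∑ s ∈ C.support, KZ.of (R' s)) := by abel
      rw [e]
      exact M₁.sub_mem (M₁.neg_mem hM) hsum

end Summit.KontsevichZagierPeriods.SymplecticScissors.RealOnePeriodRelations

end
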